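import Summits.MatrixMultiplication.MatrixMultiplication.Theorems.AbelianSTPPCensusShapeCertDefs

/-!
# Abelian STPP census — soundness of the `ShapeCert` checker for crux `ShapeExclusionTE` (part 1: semantics)

Cell mm-stpp, rung F-M1, route `AbelianSTPPCensus`; implementation B (seat eng-2).  The checker is defined in
`…Theorems.AbelianSTPPCensusShapeCertDefs`; the files `…ShapeCertSemantics` (shape arithmetic, the hereditary
sieve system `AdmM` on multisets of shapes, heredity), `…ShapeCertBudgets` (prefix aggregates versus the tail of
an admissible family), `…ShapeCertUniverse` (volume buckets, the decorated candidate list, completeness of the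
universe) and `…ShapeCertSearch` (the continuation bound, completeness of the admissibility test, the search
induction, `check_sound`) prove: `check M = true` ⇒ every `AdmM`-admissible shape multiset inside the universe
with integer gain `> 10⁶·M` contains a registered residual sub-multiset. -/
set_option linter.dupNamespace false -- `MatrixMultiplication.MatrixMultiplication` (summit = problem, D-0017)
set_option autoImplicit false

namespace Summit.MatrixMultiplication.MatrixMultiplication.Theorems.ShapeCert

open Multiset

section trip
/-! ### Shape arithmetic on triples `(a,b,c)` -/
variable (x : ℕ × ℕ × ℕ)
/-- volume `abc` -/
def vol : ℕ := x.1 * x.2.1 * x.2.2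
/-- pair product `ab` -/
def pab : ℕ := x.1 * x.2.1
/-- pair product `bc` -/
def pbc : ℕ := x.2.1 * x.2.2
/-- pair product `ca` -/
def pca : ℕ := x.2.2 * x.1
/-- U11 weight `a(b+c)` -/
def wa : ℕ := x.1 * (x.2.1 + x.2.2)
/-- U11 weight `b(c+a)` -/
def wb : ℕ := x.2.1 * (x.2.2 + x.1)
/-- U11 weight `c(a+b)` -/
def wc : ℕ := x.2.2 * (x.1 + x.2.1)
/-- largest pair product -/
def mpp3 : ℕ := max (pab x) (max (pbc x) (pca x))
/-- packing weight `ab + bc + ca` -/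
def uu : ℕ := pab x + pbc x + pca x
end trip

/-- Static universe membership of a shape at order `M`. -/
def InUniv (M : ℕ) (x : ℕ × ℕ × ℕ) : Prop := inUnivB M x.1 x.2.1 x.2.2 = true

/-- The hereditary (per-member) form of the sieve system `vM` on a multiset of member shapes at order `M`:
U2; U11 per member; U9′ pairs; U14 with the single tightness clauses U14-T; the product pair clauses U14-T″. -/
def AdmM (M : ℕ) (G : Multiset (ℕ × ℕ × ℕ)) : Prop :=
  ((G.map pab).sum ≤ M ∧ (G.map pbc).sum ≤ M ∧ (G.map pca).sum ≤ M) ∧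
  (∀ x ∈ G, (G.map wa).sum ≤ M + x.1 ∧ (G.map wb).sum ≤ M + x.2.1 ∧ (G.map wc).sum ≤ M + x.2.2) ∧
  (∀ x ∈ G, ∀ y ∈ G.erase x, mpp3 x + vol y ≤ M) ∧
  (∀ x ∈ G,
    (vol x + ((G.erase x).map pab).sum ≤ M ∧
      (vol x + ((G.erase x).map pab).sum = M → hasLCD (vol x) M x.2.2 = true)) ∧
    (vol x + ((G.erase x).map pbc).sum ≤ M ∧
      (vol x + ((G.erase x).map pbc).sum = M → hasLCD (vol x) M x.1 = true)) ∧
    (vol x + ((G.erase x).map pca).sum ≤ M ∧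
      (vol x + ((G.erase x).map pca).sum = M → hasLCD (vol x) M x.2.1 = true))) ∧
  (∀ x ∈ G,
    (vol x + ((G.erase x).map pab).sum = M → vol x + ((G.erase x).map pbc).sum = M →
      hasLCD (vol x) M (x.1 * x.2.2) = true) ∧
    (vol x + ((G.erase x).map pbc).sum = M → vol x + ((G.erase x).map pca).sum = M →
      hasLCD (vol x) M (x.2.1 * x.1) = true) ∧
    (vol x + ((G.erase x).map pca).sum = M → vol x + ((G.erase x).map pab).sum = M →
      hasLCD (vol x) M (x.2.2 * x.2.1) = true))

/-- total integer gain of a shape multiset -/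
def gsumM (G : Multiset (ℕ × ℕ × ℕ)) : ℕ := (G.map fun x => gainOf (vol x)).sum

/-- the multiset contains one of the registered residual sub-multisets at order `M` -/
def ResidM (M : ℕ) (G : Multiset (ℕ × ℕ × ℕ)) : Prop :=
  ∃ L ∈ residLists M, (L : Multiset (ℕ × ℕ × ℕ)) ≤ G

/-- the shape multiset of a prefix -/
def famT (fam : List Sh) : Multiset (ℕ × ℕ × ℕ) := ((fam.map Sh.tr : List (ℕ × ℕ × ℕ)) : Multiset _)

/-- every record of the list is the record of its own triple -/
def WfL (M : ℕ) (l : List Sh) : Prop := ∀ t ∈ l, t = shOf M t.tr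

section multiset_lemmas
/-! ### Small multiset facts -/
variable {α : Type*} [DecidableEq α]

omit [DecidableEq α] in
/-- sums of naturals are monotone under `≤` of multisets -/
theorem sum_map_le_of_le {F G : Multiset α} (h : F ≤ G) (f : α → ℕ) :
    (F.map f).sum ≤ (G.map f).sum := by
  obtain ⟨U, rfl⟩ := Multiset.le_iff_exists_add.mp h
  simp

/-- splitting a sum along `F ≤ G` -/
theorem sum_map_split {F G : Multiset α} (h : F ≤ G) (f : α → ℕ) :
    (G.map f).sum = (F.map f).sum + ((G - F).map f).sum := by
  conv_lhs => rw [← Multiset.sub_add_cancel h]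
  simp [add_comm]

/-- an element of `G - F` can be added to `F` below `G` -/
theorem cons_le_of_mem_sub {F G : Multiset α} {x : α} (h : F ≤ G) (hx : x ∈ G - F) :
    x ::ₘ F ≤ G := by
  rw [Multiset.le_iff_count]
  intro y
  have hc := Multiset.mem_sub.mp hx
  have hy := Multiset.le_iff_count.mp h y
  by_cases hxy : y = x
  · subst hxy; rw [Multiset.count_cons_self]; omega
  · rw [Multiset.count_cons_of_ne hxy]; exact hy

/-- `F` stays below `G` with an element of `G - F` erased -/
theorem le_erase_of_mem_sub {F G : Multiset α} {x : α} (h : F ≤ G) (hx : x ∈ G - F) :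
    F ≤ G.erase x := by
  have h1 := Multiset.erase_le_erase x (cons_le_of_mem_sub h hx)
  rwa [Multiset.erase_cons_head] at h1

/-- an element of `G - F` survives erasing an element of `F` from `G` -/
theorem mem_erase_of_mem_sub {F G : Multiset α} {x y : α} (h : F ≤ G) (hx : x ∈ G - F) (hy : y ∈ F) :
    x ∈ G.erase y := by
  have h1 : y ::ₘ (x ::ₘ F.erase y) ≤ G := by
    rw [Multiset.cons_swap, Multiset.cons_erase hy]; exact cons_le_of_mem_sub h hx
  have h2 := Multiset.erase_le_erase y h1
  rw [Multiset.erase_cons_head] at h2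
  exact Multiset.mem_of_le h2 (Multiset.mem_cons_self _ _)

/-- removing more leaves less -/
theorem sub_cons_le (F G : Multiset α) (x : α) : G - (x ::ₘ F) ≤ G - F := by
  rw [Multiset.le_iff_count]; intro y
  simp only [Multiset.count_sub]
  have := Multiset.count_le_of_le y (Multiset.le_cons_self F x)
  omega

/-- count domination of lists is `≤` of the multisets -/
theorem coe_le_coe_of_count {L l : List α} (h : ∀ x ∈ L, L.count x ≤ l.count x) :
    (L : Multiset α) ≤ (l : Multiset α) := by
  rw [Multiset.le_iff_count]; intro y
  simp only [Multiset.coe_count]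
  by_cases hy : y ∈ L
  · exact h y hy
  · rw [List.count_eq_zero_of_not_mem hy]; exact Nat.zero_le _

end multiset_lemmas

section foldr_lemmas
/-! ### `foldr max` / `foldr min` bounds -/

/-- a `foldr max 0` is below any common bound of the entries -/
theorem foldr_max_le {l : List ℕ} {n : ℕ} (h : ∀ y ∈ l, y ≤ n) : l.foldr max 0 ≤ n := by
  induction l with
  | nil => simp
  | cons y l ih =>
    simp only [List.foldr_cons]
    exact max_le (h y (by simp)) (ih fun z hz => h z (by simp [hz]))

/-- `X ≤ M + foldr min m l` from the bound at the start and at every entry -/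
theorem le_add_foldr_min {l : List ℕ} {X M m : ℕ} (h0 : X ≤ M + m) (h : ∀ y ∈ l, X ≤ M + y) :
    X ≤ M + l.foldr min m := by
  induction l with
  | nil => simpa using h0
  | cons y l ih =>
    simp only [List.foldr_cons]
    rcases le_total y (l.foldr min m) with hy | hy
    · rw [min_eq_left hy]; exact h y (by simp)
    · rw [min_eq_right hy]; exact ih fun z hz => h z (by simp [hz])

end foldr_lemmas

section fields
/-! ### Fields of the record of a triple -/
variable (M : ℕ) (x : ℕ × ℕ × ℕ)

/-- the record of a triple has that triple -/
@[simp] theorem shOf_tr : (shOf M x).tr = x := by rcases x with ⟨a, b, c⟩; rfl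
/-- field `a` of the record of a triple -/
@[simp] theorem shOf_a : (shOf M x).a = x.1 := rfl
/-- field `b` of the record of a triple -/
@[simp] theorem shOf_b : (shOf M x).b = x.2.1 := rfl
/-- field `c` of the record of a triple -/
@[simp] theorem shOf_c : (shOf M x).c = x.2.2 := rfl
/-- field `V` of the record of a triple -/
@[simp] theorem shOf_V : (shOf M x).V = vol x := rfl
/-- field `ab` of the record of a triple -/
@[simp] theorem shOf_ab : (shOf M x).ab = pab x := rfl
/-- field `bc` of the record of a triple -/
@[simp] theorem shOf_bc : (shOf M x).bc = pbc x := rfl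
/-- field `ca` of the record of a triple -/
@[simp] theorem shOf_ca : (shOf M x).ca = pca x := rfl
/-- field `wA` of the record of a triple -/
@[simp] theorem shOf_wA : (shOf M x).wA = wa x := rfl
/-- field `wB` of the record of a triple -/
@[simp] theorem shOf_wB : (shOf M x).wB = wb x := rfl
/-- field `wC` of the record of a triple -/
@[simp] theorem shOf_wC : (shOf M x).wC = wc x := rfl
/-- field `g` of the record of a triple -/
@[simp] theorem shOf_g : (shOf M x).g = gainOf (vol x) := rfl
/-- field `mpp` of the record of a triple -/
@[simp] theorem shOf_mpp : (shOf M x).mpp = mpp3 x := rfl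
/-- field `dab` of the record of a triple -/
theorem shOf_dab : (shOf M x).dab = vol x - pab x + (if hasLCD (vol x) M x.2.2 then 0 else 1) := rfl
/-- field `dbc` of the record of a triple -/
theorem shOf_dbc : (shOf M x).dbc = vol x - pbc x + (if hasLCD (vol x) M x.1 then 0 else 1) := rfl
/-- field `dca` of the record of a triple -/
theorem shOf_dca : (shOf M x).dca = vol x - pca x + (if hasLCD (vol x) M x.2.1 then 0 else 1) := rfl
/-- field `rho` of the record of a triple -/
theorem shOf_rho : (shOf M x).rho = gainOf (vol x) * K / uu x + 1 := rfl

end fields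

section inuniv
/-! ### Consequences of universe membership -/
variable {M : ℕ} {x : ℕ × ℕ × ℕ}

/-- universe shapes have positive sides -/
theorem InUniv.pos (h : InUniv M x) : 1 ≤ x.1 ∧ 1 ≤ x.2.1 ∧ 1 ≤ x.2.2 := by
  unfold InUniv inUnivB at h; simp only [Bool.and_eq_true, decide_eq_true_eq] at h
  exact ⟨h.1.1.1.1.1.1, h.1.1.1.1.1.2, h.1.1.1.1.2⟩

/-- U13 for universe shapes -/
theorem InUniv.vol_le (h : InUniv M x) : vol x + max x.1 (max x.2.1 x.2.2) ≤ M := by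
  unfold InUniv inUnivB at h; simp only [Bool.and_eq_true, decide_eq_true_eq] at h
  exact h.1.1.1.2

/-- universe shapes have positive volume -/
theorem InUniv.one_le_vol (h : InUniv M x) : 1 ≤ vol x := by
  obtain ⟨ha, hb, hc⟩ := h.pos
  unfold vol; exact Nat.mul_pos (Nat.mul_pos ha hb) hc

/-- `a ≤ M` in the universe -/
theorem InUniv.a_le (h : InUniv M x) : x.1 ≤ M := by
  have h1 := h.vol_le; have := le_max_left x.1 (max x.2.1 x.2.2); omega

/-- `b ≤ M` in the universe -/
theorem InUniv.b_le (h : InUniv M x) : x.2.1 ≤ M := by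
  have h1 := h.vol_le
  have := (le_max_left x.2.1 x.2.2).trans (le_max_right x.1 (max x.2.1 x.2.2)); omega

/-- `c ≤ M` in the universe -/
theorem InUniv.c_le (h : InUniv M x) : x.2.2 ≤ M := by
  have h1 := h.vol_le
  have := (le_max_right x.2.1 x.2.2).trans (le_max_right x.1 (max x.2.1 x.2.2)); omega

/-- `ab ≤ abc` in the universe -/
theorem InUniv.pab_le_vol (h : InUniv M x) : pab x ≤ vol x := by
  obtain ⟨-, -, hc⟩ := h.pos; unfold pab vol; exact Nat.le_mul_of_pos_right _ hc

/-- `bc ≤ abc` in the universe -/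
theorem InUniv.pbc_le_vol (h : InUniv M x) : pbc x ≤ vol x := by
  obtain ⟨ha, -, -⟩ := h.pos; unfold pbc vol
  calc x.2.1 * x.2.2 = 1 * (x.2.1 * x.2.2) := by ring
    _ ≤ x.1 * (x.2.1 * x.2.2) := Nat.mul_le_mul_right _ ha
    _ = x.1 * x.2.1 * x.2.2 := by ring

/-- `ca ≤ abc` in the universe -/
theorem InUniv.pca_le_vol (h : InUniv M x) : pca x ≤ vol x := by
  obtain ⟨-, hb, -⟩ := h.pos; unfold pca vol
  calc x.2.2 * x.1 = 1 * (x.2.2 * x.1) := by ring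
    _ ≤ x.2.1 * (x.2.2 * x.1) := Nat.mul_le_mul_right _ hb
    _ = x.1 * x.2.1 * x.2.2 := by ring

/-- the largest pair product is at most `M` -/
theorem InUniv.mpp_le (h : InUniv M x) : mpp3 x ≤ M := by
  have hv := h.vol_le
  have h1 := h.pab_le_vol; have h2 := h.pbc_le_vol; have h3 := h.pca_le_vol
  unfold mpp3
  refine max_le ?_ (max_le ?_ ?_) <;> omega

/-- `a(b+c) ≥ 2` in the universe -/
theorem InUniv.two_le_wa (h : InUniv M x) : 2 ≤ wa x := by
  obtain ⟨ha, hb, hc⟩ := h.pos; unfold wa; nlinarith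

/-- `b(c+a) ≥ 2` in the universe -/
theorem InUniv.two_le_wb (h : InUniv M x) : 2 ≤ wb x := by
  obtain ⟨ha, hb, hc⟩ := h.pos; unfold wb; nlinarith

/-- `c(a+b) ≥ 2` in the universe -/
theorem InUniv.two_le_wc (h : InUniv M x) : 2 ≤ wc x := by
  obtain ⟨ha, hb, hc⟩ := h.pos; unfold wc; nlinarith

/-- `ab+bc+ca > 0` in the universe -/
theorem InUniv.uu_pos (h : InUniv M x) : 0 < uu x := by
  obtain ⟨ha, hb, hc⟩ := h.pos; unfold uu pab; nlinarith

/-- `x(y+z) ≥ 2√V`: `4V ≤ (a(b+c))²`, needs `a ≥ 1` -/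
theorem InUniv.four_vol_le_wa_sq (h : InUniv M x) : 4 * vol x ≤ wa x * wa x := by
  obtain ⟨ha, hb, hc⟩ := h.pos; unfold vol wa
  have h1 : 4 * (x.2.1 * x.2.2) ≤ (x.2.1 + x.2.2) * (x.2.1 + x.2.2) := by
    nlinarith [Nat.zero_le ((x.2.1 + x.2.2) * (x.2.1 + x.2.2)), sq_nonneg ((x.2.1 : ℤ) - x.2.2)]
  calc 4 * (x.1 * x.2.1 * x.2.2) = x.1 * (4 * (x.2.1 * x.2.2)) := by ring
    _ ≤ x.1 * ((x.2.1 + x.2.2) * (x.2.1 + x.2.2)) := Nat.mul_le_mul_left _ h1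
    _ ≤ (x.1 * x.1) * ((x.2.1 + x.2.2) * (x.2.1 + x.2.2)) :=
        Nat.mul_le_mul_right _ (by nlinarith)
    _ = x.1 * (x.2.1 + x.2.2) * (x.1 * (x.2.1 + x.2.2)) := by ring

/-- `4V ≤ (b(c+a))²` -/
theorem InUniv.four_vol_le_wb_sq (h : InUniv M x) : 4 * vol x ≤ wb x * wb x := by
  have h' : InUniv M (x.2.1, x.2.2, x.1) := by
    unfold InUniv inUnivB at *; simp only [Bool.and_eq_true, decide_eq_true_eq] at *
    obtain ⟨⟨⟨⟨⟨⟨h1, h2⟩, h3⟩, h4⟩, h5⟩, h6⟩, h7⟩ := h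
    refine ⟨⟨⟨⟨⟨⟨h2, h3⟩, h1⟩, ?_⟩, h6⟩, h7⟩, h5⟩
    have : max x.2.1 (max x.2.2 x.1) = max x.1 (max x.2.1 x.2.2) := by omega
    rw [this]; linarith
  have := h'.four_vol_le_wa_sq
  unfold vol wa at this; unfold vol wb
  calc 4 * (x.1 * x.2.1 * x.2.2) = 4 * (x.2.1 * x.2.2 * x.1) := by ring
    _ ≤ _ := this

/-- `4V ≤ (c(a+b))²` -/
theorem InUniv.four_vol_le_wc_sq (h : InUniv M x) : 4 * vol x ≤ wc x * wc x := by
  have h' : InUniv M (x.2.2, x.1, x.2.1) := by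
    unfold InUniv inUnivB at *; simp only [Bool.and_eq_true, decide_eq_true_eq] at *
    obtain ⟨⟨⟨⟨⟨⟨h1, h2⟩, h3⟩, h4⟩, h5⟩, h6⟩, h7⟩ := h
    refine ⟨⟨⟨⟨⟨⟨h3, h1⟩, h2⟩, ?_⟩, h7⟩, h5⟩, h6⟩
    have : max x.2.2 (max x.1 x.2.1) = max x.1 (max x.2.1 x.2.2) := by omega
    rw [this]; linarith
  have := h'.four_vol_le_wa_sq
  unfold vol wa at this; unfold vol wc
  calc 4 * (x.1 * x.2.1 * x.2.2) = 4 * (x.2.2 * x.1 * x.2.1) := by ring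
    _ ≤ _ := this

/-- AM–GM for the three pair products: `27 V² ≤ (ab+bc+ca)³` -/
theorem vol_sq_le_uu_cube (x : ℕ × ℕ × ℕ) : 27 * (vol x * vol x) ≤ uu x ^ 3 := by
  unfold vol uu pab pbc pca
  set p := x.1 * x.2.1; set q := x.2.1 * x.2.2; set r := x.2.2 * x.1
  have hv : x.1 * x.2.1 * x.2.2 * (x.1 * x.2.1 * x.2.2) = p * q * r := by simp only [p, q, r]; ring
  rw [hv]
  have key : (27 : ℤ) * (p * q * r) ≤ ((p : ℤ) + q + r) ^ 3 := by
    nlinarith [sq_nonneg ((p : ℤ) - q), sq_nonneg ((q : ℤ) - r), sq_nonneg ((r : ℤ) - p),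
      mul_nonneg (mul_nonneg (Int.natCast_nonneg p) (Int.natCast_nonneg q)) (Int.natCast_nonneg r),
      mul_nonneg (Int.natCast_nonneg p) (sq_nonneg ((q : ℤ) - r)),
      mul_nonneg (Int.natCast_nonneg q) (sq_nonneg ((r : ℤ) - p)),
      mul_nonneg (Int.natCast_nonneg r) (sq_nonneg ((p : ℤ) - q))]
  exact_mod_cast key

end inuniv

section heredity
/-! ### `AdmM` is hereditary -/

/-- **Heredity**: the sieve system passes to sub-multisets -/
theorem AdmM.mono {M : ℕ} {F G : Multiset (ℕ × ℕ × ℕ)} (h : AdmM M G) (hF : F ≤ G) : AdmM M F := by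
  obtain ⟨⟨h2a, h2b, h2c⟩, h11, h9, h14, hT⟩ := h
  have hs := fun f => sum_map_le_of_le hF f
  have he := fun x f => sum_map_le_of_le (Multiset.erase_le_erase x hF) f
  have hm := fun x (hx : x ∈ F) => Multiset.mem_of_le hF hx
  refine ⟨⟨(hs pab).trans h2a, (hs pbc).trans h2b, (hs pca).trans h2c⟩, ?_, ?_, ?_, ?_⟩
  · intro x hx; obtain ⟨u1, u2, u3⟩ := h11 x (hm x hx)
    exact ⟨(hs wa).trans u1, (hs wb).trans u2, (hs wc).trans u3⟩
  · intro x hx y hy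
    exact h9 x (hm x hx) y (Multiset.mem_of_le (Multiset.erase_le_erase x hF) hy)
  · intro x hx; obtain ⟨⟨a1, a2⟩, ⟨b1, b2⟩, ⟨c1, c2⟩⟩ := h14 x (hm x hx)
    have e1 := he x pab; have e2 := he x pbc; have e3 := he x pca
    refine ⟨⟨by omega, fun h => a2 (by omega)⟩, ⟨by omega, fun h => b2 (by omega)⟩,
      ⟨by omega, fun h => c2 (by omega)⟩⟩
  · intro x hx; obtain ⟨t1, t2, t3⟩ := hT x (hm x hx)
    obtain ⟨⟨a1, -⟩, ⟨b1, -⟩, ⟨c1, -⟩⟩ := h14 x (hm x hx)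
    have e1 := he x pab; have e2 := he x pbc; have e3 := he x pca
    exact ⟨fun p q => t1 (by omega) (by omega), fun p q => t2 (by omega) (by omega),
      fun p q => t3 (by omega) (by omega)⟩

/-- residual sub-multisets persist in super-multisets -/
theorem ResidM.mono {M : ℕ} {F G : Multiset (ℕ × ℕ × ℕ)} (h : ResidM M F) (hF : F ≤ G) : ResidM M G := by
  obtain ⟨L, hL, hle⟩ := h; exact ⟨L, hL, hle.trans hF⟩

end heredity

end Summit.MatrixMultiplication.MatrixMultiplication.Theorems.ShapeCert
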